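import Mathlib.Algebra.Polynomial.Eval.Defs
import Mathlib.Algebra.Polynomial.Coeff
import Mathlib.Algebra.Polynomial.Div
import Literature.Analysis.ValidatedNumerics.IntervalPolynomial
import HarnessLib

/-!
# Coefficient lists as polynomials

Trunk T-ANA (Analysis/ValidatedNumerics); namespace `Literature.Analysis.ValidatedNumerics.PolyMP`.
The real "shadow" coefficient lists of `IntervalPolynomial.lean` (`evalR`, `addR`, `smulR`,
`mulR`) are related to Mathlib's `Polynomial ℝ` (`toPoly`), so that *coefficient* identities
(Cauchy products, vanishing of low-order coefficients and the resulting exact factorisation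
`p = Xⁿ · q`) can be transported to the validated-numerics side, where only *values* are compared.
This is what turns "the first `n` Taylor coefficients vanish identically" into a factor `tⁿ` in a
certified sign condition (the typical use: a barrier polynomial vanishing to high order at an
equilibrium, as in the computer-assisted barrier arguments of Buckmaster–Cao-Labora–Gómez-Serrano
near the sonic point). No facts, no axioms.

## References

* [folklore] (polynomial arithmetic on coefficient lists).
* T. Buckmaster, G. Cao-Labora, J. Gómez-Serrano, *Smooth imploding solutions for 3D compressible
  fluids*, Forum Math. Pi 13 (2025) e6, §3 (the barrier polynomial `P^{nl}_n`, Prop. 3.5) and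
  Prop. 5.11 (its leading term is of order `s^{n+1}` at `P_s`) — motivation only.
  [cite: BuckmasterCaolaboraGomezserrano2025, Prop. 3.5, Prop. 5.11]
-/

noncomputable section

open Polynomial

namespace Literature.Analysis.ValidatedNumerics

namespace PolyMP

/-- The polynomial with the given coefficient list (Horner form). [folklore] -/
def toPoly : List ℝ → ℝ[X]
  | [] => 0
  | a :: as => C a + X * toPoly as

/-- [folklore] -/
@[simp] theorem toPoly_nil : toPoly [] = 0 := rfl

/-- [folklore] -/
@[simp] theorem toPoly_cons (a : ℝ) (as : List ℝ) : toPoly (a :: as) = C a + X * toPoly as := rfl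

/-- [folklore] -/
theorem eval_toPoly : ∀ (as : List ℝ) (x : ℝ), (toPoly as).eval x = evalR as x
  | [], x => by simp
  | a :: as, x => by simp [eval_toPoly as x]

/-- [folklore] -/
theorem toPoly_addR : ∀ (as bs : List ℝ), toPoly (addR as bs) = toPoly as + toPoly bs
  | [], bs => by simp [addR]
  | a :: as, [] => by simp [addR]
  | a :: as, b :: bs => by
      simp only [addR, toPoly_cons, toPoly_addR as bs, C_add]; ring

/-- [folklore] -/
theorem toPoly_smulR (c : ℝ) : ∀ (as : List ℝ), toPoly (smulR c as) = C c * toPoly as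
  | [] => by simp [smulR]
  | a :: as => by
      have := toPoly_smulR c as
      simp only [smulR, List.map_cons, toPoly_cons, C_mul] at this ⊢
      rw [this]; ring

/-- [folklore] -/
theorem toPoly_mulR : ∀ (as bs : List ℝ), toPoly (mulR as bs) = toPoly as * toPoly bs
  | [], bs => by simp [mulR]
  | a :: as, bs => by
      simp only [mulR, toPoly_addR, toPoly_smulR, toPoly_cons, toPoly_mulR as bs, C_0, zero_add]
      ring

/-- [folklore] -/
theorem toPoly_neg : ∀ (as : List ℝ), toPoly (as.map Neg.neg) = -toPoly as
  | [] => by simp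
  | a :: as => by simp only [List.map_cons, toPoly_cons, toPoly_neg as, C_neg]; ring

/-- Coefficients are the list entries. [folklore] -/
theorem coeff_toPoly : ∀ (as : List ℝ) (n : ℕ), (toPoly as).coeff n = as.getD n 0
  | [], n => by simp
  | a :: as, 0 => by simp
  | a :: as, n + 1 => by
      simp only [toPoly_cons, coeff_add, coeff_C_succ, coeff_X_mul, zero_add, coeff_toPoly as n,
        List.getD_cons_succ]

/-- Prepending `k` zeros multiplies by `X^k`. [folklore] -/
theorem toPoly_replicate_append (k : ℕ) (as : List ℝ) :
    toPoly (List.replicate k 0 ++ as) = X ^ k * toPoly as := by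
  induction k with
  | zero => simp
  | succ k ih => simp only [List.replicate_succ, List.cons_append, toPoly_cons, ih, C_0, zero_add]; ring

/-- Splitting at an index: `p = (take n) + Xⁿ · (drop n)`. [folklore] -/
theorem toPoly_take_add_drop : ∀ (n : ℕ) (as : List ℝ),
    toPoly as = toPoly (as.take n) + X ^ n * toPoly (as.drop n)
  | 0, as => by simp
  | n + 1, [] => by simp
  | n + 1, a :: as => by
      simp only [List.take_succ_cons, List.drop_succ_cons, toPoly_cons, toPoly_take_add_drop n as]
      ring

/-- If the first `n` entries vanish, the list polynomial is `Xⁿ` times the polynomial of the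
remaining entries. [folklore] -/
theorem toPoly_eq_X_pow_mul_drop {n : ℕ} {as : List ℝ} (h : ∀ d < n, as.getD d 0 = 0) :
    toPoly as = X ^ n * toPoly (as.drop n) := by
  have htake : toPoly (as.take n) = 0 := by
    ext d
    rw [coeff_toPoly, coeff_zero]
    by_cases hd : d < n
    · rw [List.getD_eq_getElem?_getD, List.getElem?_take_of_lt hd, ← List.getD_eq_getElem?_getD]
      exact h d hd
    · rw [List.getD_eq_getElem?_getD, List.getElem?_eq_none]
      · rfl
      · simp only [List.length_take]; omega
  rw [toPoly_take_add_drop n as, htake, zero_add]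

/-- The same, read off the polynomial: vanishing of the low coefficients of `toPoly as`.
[folklore] -/
theorem toPoly_eq_X_pow_mul_drop' {n : ℕ} {as : List ℝ} (h : ∀ d < n, (toPoly as).coeff d = 0) :
    toPoly as = X ^ n * toPoly (as.drop n) :=
  toPoly_eq_X_pow_mul_drop fun d hd => by rw [← coeff_toPoly]; exact h d hd

/-- Value form of the factorisation. [folklore] -/
theorem evalR_eq_pow_mul_drop {n : ℕ} {as : List ℝ} (h : ∀ d < n, (toPoly as).coeff d = 0)
    (x : ℝ) : evalR as x = x ^ n * evalR (as.drop n) x := by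
  have := congrArg (fun p => p.eval x) (toPoly_eq_X_pow_mul_drop' h)
  simpa [eval_toPoly] using this

/-- Coefficients of a product of lists: the Cauchy sum over `range (n+1)`. [folklore] -/
theorem getD_mulR (as bs : List ℝ) (n : ℕ) :
    (mulR as bs).getD n 0 = ∑ k ∈ Finset.range (n + 1), as.getD k 0 * bs.getD (n - k) 0 := by
  rw [← coeff_toPoly, toPoly_mulR, coeff_mul, Finset.Nat.sum_antidiagonal_eq_sum_range_succ_mk]
  simp only [coeff_toPoly]

/-- [folklore] -/
theorem getD_addR (as bs : List ℝ) (n : ℕ) :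
    (addR as bs).getD n 0 = as.getD n 0 + bs.getD n 0 := by
  rw [← coeff_toPoly, toPoly_addR, coeff_add, coeff_toPoly, coeff_toPoly]

/-- [folklore] -/
theorem getD_smulR (c : ℝ) (as : List ℝ) (n : ℕ) :
    (smulR c as).getD n 0 = c * as.getD n 0 := by
  rw [← coeff_toPoly, toPoly_smulR, coeff_C_mul, coeff_toPoly]

end PolyMP

end Literature.Analysis.ValidatedNumerics
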